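import Summits.HodgeConjecture.HodgeConjecture.Theses.FiniteTreeOfFlavours
import Summits.HodgeConjecture.HodgeConjecture.Theses.QbarEnvelope
import Summits.HodgeConjecture.HodgeConjecture.Theorems.LinearSystemTorelliMiddleDivisorSupportFourfoldStubDominantEnvelope
import Summits.HodgeConjecture.HodgeConjecture.Theorems.LinearSystemTorelliMiddleDivisorSupportFourfoldStubFiniteMonodromyOfTypeStability
import Literature.AlgebraicGeometry.HodgeTheory.ContinuationLoopsZariskiOpen
import Literature.AlgebraicGeometry.HodgeTheory.AlgebraicCyclesDefinedOverQbarSpread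
import Literature.AlgebraicGeometry.HodgeTheory.HodgeConjectureQbarVoisin
import Literature.AlgebraicGeometry.HodgeTheory.HodgeGenericQbarDescent
import Literature.AlgebraicGeometry.HodgeTheory.SpreadingOutQbarFamilyProofs
import Literature.AlgebraicGeometry.HodgeTheory.IsoTransport
import Literature.AlgebraicGeometry.HodgeTheory.UniversalHypersurfaceHodgeLoci

/-!
# Line `kou-funnel` — the MOVABLE half of `FiniteTreeOfFlavours` through Voisin's `ℚ̄`-funnel:
# type stability of movable classes at `ℚ̄`-generic points (Klingler–Otwinowska–Urbanik) + HC over number fields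

Alternative skeleton (crux-strategist `cstrat-stmt-HodgeConjecture-1493-s2`, 2026-08-17) for the crux
`MovableClassesAlgebraic` (stmt-HodgeConjecture-1493, rank 3 of route `FiniteTreeOfFlavours`):

  every rational `(k,k)`-class `c` on a smooth hypersurface `X ⊂ ℙⁿ⁺¹_ℂ` that MOVES (`Moves n X k c`: `c`
  is the restriction of a rational `(k,k)`-class on a smooth projective `(n+1)`-fold fibred over a smooth
  projective curve, `X` a fibre, finitely many fibres `≅ X`) is algebraic.

It is registered NEXT TO the live line `Lines/birth.lean` ("explain the class at the generic fibre of the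
moving family, then specialise"), whose heart `stub_genericFibres` is the Hodge conjecture at the generic
point of the family. This line does not touch the moving family at all. It runs the movable class through
VOISIN'S `ℚ̄`-FUNNEL (Voisin 2007, Prop. 1.7 = Charles–Schnell, Thm. 11.3.19): spread `X` out over `ℚ̄`
(`e : X ≅ 𝒳_s`, `s` over the generic point of a smooth irreducible quasi-projective `ℚ̄`-base — PROVED in
the tree, `spreadingOut_smoothProjective_qbarFamily_holds`); IF the transported class `α = (e⁻¹)^* c`
is TYPE-STABLE along loops at `s` (its flat continuations stay of type `(k,k)` — equivalently, the
Hodge-locus component through `(s, α)` contains the `ℚ̄`-Zariski closure of `s`), then its monodromy orbit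
is finite (Hodge–Riemann + lattice finiteness — PROVED,
`Theorems.linearSystemTorelli_finite_setOf_isContinuationAlong_of_forall_isOfHodgeType`), hence after a
finite étale base change over `ℚ̄` it is a global invariant section, hence (théorème de la partie fixe +
semisimplicity) the restriction of a rational `(k,k)`-class `c'` on a smooth projective variety `W`
DEFINED OVER A NUMBER FIELD (the compactified total space), and the Hodge conjecture OVER NUMBER FIELDS
applied to `W` (not to `X`, which may be transcendental!) makes `c'`, hence `c = (e.hom ≫ ι)^* c'`,
algebraic. The one step that is not classical is TYPE STABILITY, and for MOVABLE classes on
hypersurfaces it is the theorem-in-progress of Klingler–Otwinowska–Urbanik: a special subvariety of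
`U_{n,d}` that is positive dimensional for the variation and WEAKLY NON-FACTOR is defined over `ℚ̄`
(KOU 2023, Thm. 1.12 (a)); maximal positive-dimensional ones always are (Cor. 1.13, `G^ad` simple);
points — the RIGID classes — are the open case (Cor. 1.14), which in this route is the separate crux
`RigidImpliesQbar`. So the movable/rigid dichotomy of the route IS the positive-dimensional/point
dichotomy of the field-of-definition problem for Hodge loci, and this line makes the movable half ride it.

STUBS (5; `sorry` only inside `stub_*`):

* `stub_lefschetzPackage` (KNOWN — Lefschetz hyperplane theorem + Lefschetz `(1,1)`): on a smooth
  `(n,d)`-hypersurface every rational `(k,k)`-class with `2k ≠ n` or `k ≤ 1` is algebraic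
  (`H²ᵏ(X) = ℂ·hᵏ` off the middle degree, Voisin II Cor. 1.24–1.25; divisors by Lefschetz `(1,1)`,
  Voisin I Thm. 11.30). Leaves the middle degree `n = 2k ≥ 4`.
* `stub_typeStabilityOfMovable` (THE HEART — "KOU for movable classes"): for a `ℚ̄`-spread
  `f₀ : 𝒳₀ ⟶ S₀` (quasi-projective, `S₀` smooth irreducible, smooth projective complexification of
  relative dimension `n`), a complex point `s` over the generic point of `S₀` whose fibre is a smooth
  `(n,d)`-hypersurface, `n = 2p ≥ 4`, and a rational `(p,p)`-class `α` on the fibre that MOVES: there is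
  a proper Zariski-closed `Z₀ ⊊ S₀` such that every flat continuation of `α` along a loop at `s` over
  `S₀ ∖ Z₀` is of type `(p,p)`. This is VERBATIM the transcendence kernel `T`
  (`stub_typeStabilityAtQbarGenericZariskiLocal`) of the `Envelope` crux's skeleton
  (`Cruxes/Envelope/Lines/birth.lean`, route `QbarEnvelope`) RESTRICTED to movable middle-degree
  hypersurface classes — the part of `T` where a theorem exists: the Hodge-locus component `Z_c` of a
  movable class in the universal family `U_{n,d}` is positive dimensional for the variation (a
  non-isotrivial family has infinite monodromy), and KOU Thm. 1.12 (a) makes it `ℚ̄`-definable whenever it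
  is weakly non-factor (always, if maximal: Cor. 1.13); `ℚ̄`-definable `Z_c ∋ [X]` contains the
  `ℚ̄`-closure of `[X]`, i.e. the image of the spread, so `α` stays Hodge along the spread. OPEN RESIDUE:
  "factor" components (monodromy a strict normal factor of a larger special subvariety's). Why it might
  fail: a positive-dimensional component of the Hodge locus of `U_{n,d}` of vector type NOT defined over
  `ℚ̄` through a point whose `ℚ̄`-closure leaves it — then HC fails as well (Voisin 2007, §0: under HC
  Hodge loci are countable unions of `ℚ̄`-varieties).
* `stub_envelopeOfFiniteMonodromy` (CLASSICAL — Voisin's mechanism, Prop. 1.7 / Charles–Schnell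
  Thm. 11.3.19; in the tree = the PROVED `Theorems.stub_dominantEnvelopeOfFiniteMonodromy` (p119525) fed
  with Riemann's existence theorem with `ℚ̄`-descent (`riemannExistence_qbarDescent_of_finiteIndex`, the
  `Envelope` skeleton's stub C), Deligne's partie fixe (`deligne_globalInvariantCycles`, item
  stmt-HodgeConjecture-16363) and number-field descent of smooth projective `ℚ̄`-schemes (EGA IV₃ 8.8.2,
  the `Envelope` skeleton's stub N) — the reduction is PROVED below, `envelopeOfFiniteMonodromy_of_inputs`):
  a rational `(p,p)`-class at a `ℚ̄`-generic point with FINITE continuation orbit is `ι^* c'` for a rational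
  `(p,p)`-class `c'` on a smooth projective `W` definable over a number field.
* `stub_hcOverNumberFields` = `Theses.QbarEnvelope.HCOverNumberFields` BY NAME (stmt-HodgeConjecture-1070,
  crux 3 of route `QbarEnvelope`; shared, staffed once): the Hodge conjecture for smooth projective
  complex varieties definable over a number field.
* `stub_pullbackAlgebraic` = `Theses.QbarEnvelope.PullbackAlgebraic` BY NAME (stmt-HodgeConjecture-1071,
  support; theorem in print, Fulton Ch. 6/§8.1/Cor. 19.2): pull-back along a morphism of smooth projective
  varieties preserves algebraic classes.

COMPOSITION `MovableClassesAlgebraic_of` (kernel-checked, no `sorry`): off the middle degree or for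
`k ≤ 1`, stub 1. Else fix `σ : ℚ̄ →+* ℂ`, spread `X` (PROVED), transport the hypersurface structure, the
class and the moving datum along `e : X ≅ 𝒳_s` (`IsSmoothHypersurface.of_iso`, `Moves.of_iso` — proved
here), get Zariski-local type stability from the heart, globalise it by the tree's loop-shrinking theorem
(`IsContinuationAlong.exists_loop_forall_base_pt_notMem_of_qbarFamily`, p136872), get the finite orbit
(PROVED), the number-field envelope (stub 3), algebraicity of `c'` on `W` (stub 4) and of
`c = (e.hom ≫ ι)^* c'` (stub 5, `Iso.complexBetti_map_hom_map_inv`).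

PROVED SANITY: `envelopeOfFiniteMonodromy_of_inputs` (stub 3 ⇐ C ∧ D ∧ N, via the proved B);
`typeStabilityOfMovable_of_T` (the heart is implied by the `Envelope` skeleton's kernel T verbatim);
`of_qbarEnvelope` (the whole crux is implied by the three items of route `QbarEnvelope` — the portfolio
junction made formal; this line refines `Envelope` to its movable-hypersurface part, where KOU applies).

Disproof used: none relevant — `ledger crux ls stmt-HodgeConjecture-1493` lists no `Disproof.lean`, no
`_false_without_` theorem, no `Negative/` lemma (2026-08-17); `ledger negatives --problem HodgeConjecture`
(MilnorK symbol lift, Fermat-K3 multisets, E-line matrices) touches no stub. Dead lines: none recorded.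
-/

set_option linter.dupNamespace false

noncomputable section

namespace Summit.HodgeConjecture.HodgeConjecture.Cruxes.MovableClassesAlgebraic.KouFunnel

open CategoryTheory AlgebraicGeometry Topology
open Literature.AlgebraicGeometry Literature.AlgebraicGeometry.Motives
open Literature.AlgebraicGeometry.HodgeTheory
open Literature.AlgebraicTopology.SingularHomology
open Summit.HodgeConjecture.HodgeConjecture.Theses.FiniteTreeOfFlavours (MovableClassesAlgebraic)

/-! ### Local vocabulary: the route's "moves" predicate (verbatim) and its transport along isomorphisms -/

/-- `c ∈ H²ᵏ(X(ℂ); ℂ)` **moves** — VERBATIM the existential of the route's cruxes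
(`MovableClassesAlgebraic`, `RigidImpliesQbar`, `RigidQbarClassesAlgebraic`; byte-equal to
`Cruxes/RigidImpliesQbar/Lines/birth.lean`'s `Moves`): `c` is the restriction of a rational
`(k,k)`-class `Λ` on a smooth projective `(n+1)`-fold `𝒴 → C` over a smooth projective curve having `X`
as the fibre over `t` and only finitely many fibres `≅ X`.
[cite: BaldiKlinglerUllmo2024, §2 (movable vs. atypical of zero period dimension, p. 5)] -/
def Moves (n : ℕ) (X : SchemeOver ℂ) (k : ℕ) (c : complexBetti X (2 * k)) : Prop :=
  ∃ (𝒴 C : SchemeOver ℂ) (π : 𝒴 ⟶ C) (t : AlgPoints C ℂ) (e : X ≅ fiberOver π t)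
    (Λ : complexBetti 𝒴 (2 * k)),
    IsSmoothProjective (n + 1) 𝒴 ∧ IsSmoothProjective 1 C ∧ IsRationalClass Λ ∧
      IsOfHodgeType (n + 1) 𝒴 (2 * k) k k Λ ∧
      (complexBetti.map (e.hom ≫ fiberι π t) (2 * k)).hom Λ = c ∧
      Set.Finite {t' : AlgPoints C ℂ | Nonempty (fiberOver π t' ≅ X)}

/-- **The moving datum transports along an isomorphism** `e : X ≅ X'`: if `c` moves on `X` then
`(e⁻¹)^* c` moves on `X'` (same family; compose the fibre identification with `e.symm`; the set of
parameters with fibre `≅ X'` is the set with fibre `≅ X`). [folklore] -/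
theorem Moves.of_iso {n k : ℕ} {X X' : SchemeOver ℂ} (e : X ≅ X') {c : complexBetti X (2 * k)}
    (h : Moves n X k c) : Moves n X' k (complexBetti.map e.inv (2 * k) c) := by
  obtain ⟨𝒴, C, π, t, e₀, Λ, h𝒴, hC, hΛ, hΛkk, hres, hfin⟩ := h
  refine ⟨𝒴, C, π, t, e.symm ≪≫ e₀, Λ, h𝒴, hC, hΛ, hΛkk, ?_, ?_⟩
  · rw [← hres, Iso.trans_hom, Iso.symm_hom, Category.assoc, complexBetti.map_comp,
      ModuleCat.hom_comp, LinearMap.comp_apply]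
  · have hset : {t' : AlgPoints C ℂ | Nonempty (fiberOver π t' ≅ X')} =
        {t' : AlgPoints C ℂ | Nonempty (fiberOver π t' ≅ X)} := by
      ext t'
      exact ⟨fun ⟨i⟩ ↦ ⟨i ≪≫ e.symm⟩, fun ⟨i⟩ ↦ ⟨i ≪≫ e⟩⟩
    rw [hset]
    exact hfin

/-- `MovableClassesAlgebraic` is, definitionally, "every class that `Moves` is algebraic". [folklore] -/
theorem movableClassesAlgebraic_iff :
    MovableClassesAlgebraic ↔
      ∀ ⦃n d : ℕ⦄ ⦃X : SchemeOver ℂ⦄, IsSmoothHypersurface n d X →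
        ∀ (k : ℕ) (c : complexBetti X (2 * k)), IsRationalClass c → IsOfHodgeType n X (2 * k) k k c →
          Moves n X k c → c ∈ algebraicClasses X k :=
  Iff.rfl

/-! ### The statements of the five stubs, by name -/

namespace Stubs

/-- Statement of STUB 1 (`stub_lefschetzPackage`, KNOWN): off the middle degree, or in codimension
`≤ 1`, every rational `(k,k)`-class of a smooth hypersurface is algebraic.
[cite: VoisinHodgeII2003, Cor. 1.24 and Cor. 1.25] [cite: VoisinHodgeI2002, Thm. 11.30 (Lefschetz theorem on (1,1)-classes)] -/
def stub_lefschetzPackage : Prop :=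
  ∀ ⦃n d : ℕ⦄ ⦃X : SchemeOver ℂ⦄, IsSmoothHypersurface n d X →
    ∀ k : ℕ, (2 * k ≠ n ∨ k ≤ 1) → ∀ c : complexBetti X (2 * k), IsRationalClass c →
      IsOfHodgeType n X (2 * k) k k c → c ∈ algebraicClasses X k

/-- Statement of STUB 2 (`stub_typeStabilityOfMovable`, THE HEART): type stability of MOVABLE
middle-degree hypersurface classes at `ℚ̄`-generic points, Zariski-locally on the base.
[cite: KlinglerOtwinowskaUrbanik2023, Thm. 1.12 (a) and Cor. 1.13] [cite: Voisin2007HodgeLoci, Thm. 1.5 (2) and Prop. 1.7] -/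
def stub_typeStabilityOfMovable : Prop :=
  ∀ (σ : AlgebraicClosure ℚ →+* ℂ) ⦃𝒳₀ S₀ : SchemeOver (AlgebraicClosure ℚ)⦄ (f₀ : 𝒳₀ ⟶ S₀)
    (n p d : ℕ), IsQuasiProjectiveOver 𝒳₀ → IsQuasiProjectiveOver S₀ → IrreducibleSpace S₀.left →
    AlgebraicGeometry.Smooth S₀.hom → IsSmoothProjectiveFamily ((baseChangeHom σ).map f₀) n →
    ∀ (s : ComplexPoints ((baseChangeHom σ).obj S₀)),
      closure {(baseChangeHomFst σ S₀).base s.pt} = (Set.univ : Set S₀.left) →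
      IsSmoothHypersurface n d (fiberOver ((baseChangeHom σ).map f₀) s) → 2 * p = n → 2 ≤ p →
      ∀ (α : complexBetti (fiberOver ((baseChangeHom σ).map f₀) s) (2 * p)),
        IsRationalClass α → IsOfHodgeType n (fiberOver ((baseChangeHom σ).map f₀) s) (2 * p) p p α →
        Moves n (fiberOver ((baseChangeHom σ).map f₀) s) p α →
        ∃ Z₀ : Set S₀.left, IsClosed Z₀ ∧ Z₀ ≠ Set.univ ∧
          ∀ (γ : Path s s), (∀ u, (baseChangeHomFst σ S₀).base (γ u).pt ∉ Z₀) →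
            ∀ (β : complexBetti (fiberOver ((baseChangeHom σ).map f₀) s) (2 * p)),
              IsContinuationAlong γ α β →
                IsOfHodgeType n (fiberOver ((baseChangeHom σ).map f₀) s) (2 * p) p p β

/-- Statement of STUB 3 (`stub_envelopeOfFiniteMonodromy`, CLASSICAL): a rational `(p,p)`-class with
finite continuation orbit at a `ℚ̄`-generic point of a `ℚ̄`-spread is the pull-back of a rational
`(p,p)`-class on a smooth projective variety definable over a number field.
[cite: Voisin2007HodgeLoci, Prop. 1.7 (proof)] [cite: CharlesSchnell2014Notes, Thm. 11.3.19] -/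
def stub_envelopeOfFiniteMonodromy : Prop :=
  ∀ (σ : AlgebraicClosure ℚ →+* ℂ) ⦃𝒳₀ S₀ : SchemeOver (AlgebraicClosure ℚ)⦄ (f₀ : 𝒳₀ ⟶ S₀)
    (n p : ℕ), IsQuasiProjectiveOver 𝒳₀ → IsQuasiProjectiveOver S₀ → IrreducibleSpace S₀.left →
    AlgebraicGeometry.Smooth S₀.hom → IsSmoothProjectiveFamily ((baseChangeHom σ).map f₀) n →
    ∀ (s : ComplexPoints ((baseChangeHom σ).obj S₀)),
      closure {(baseChangeHomFst σ S₀).base s.pt} = (Set.univ : Set S₀.left) →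
      ∀ (α : complexBetti (fiberOver ((baseChangeHom σ).map f₀) s) (2 * p)),
        IsRationalClass α → IsOfHodgeType n (fiberOver ((baseChangeHom σ).map f₀) s) (2 * p) p p α →
        {β : complexBetti (fiberOver ((baseChangeHom σ).map f₀) s) (2 * p) |
            ∃ γ : Path s s, IsContinuationAlong γ α β}.Finite →
        ∃ (m : ℕ) (W : SchemeOver ℂ) (ι : fiberOver ((baseChangeHom σ).map f₀) s ⟶ W)
          (c' : complexBetti W (2 * p)),
          IsSmoothProjective m W ∧
          (∃ (K : Type) (_ : Field K) (_ : NumberField K) (τ : K →+* ℂ) (W₀ : SchemeOver K),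
              Nonempty (W ≅ (baseChangeHom τ).obj W₀)) ∧
          IsRationalClass c' ∧ IsOfHodgeType m W (2 * p) p p c' ∧ complexBetti.map ι (2 * p) c' = α

/-- Statement of STUB 4 (`stub_hcOverNumberFields`): the shared crux stmt-HodgeConjecture-1070 of route
`QbarEnvelope`, BY NAME. [cite: Voisin2007HodgeLoci, Prop. 1.7] -/
def stub_hcOverNumberFields : Prop :=
  Summit.HodgeConjecture.HodgeConjecture.Theses.QbarEnvelope.HCOverNumberFields

/-- Statement of STUB 5 (`stub_pullbackAlgebraic`): the shared support item stmt-HodgeConjecture-1071 of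
route `QbarEnvelope`, BY NAME. [cite: Fulton1998, Ch. 6, §8.1 and Cor. 19.2] -/
def stub_pullbackAlgebraic : Prop :=
  Summit.HodgeConjecture.HodgeConjecture.Theses.QbarEnvelope.PullbackAlgebraic

end Stubs

/-! ### The five registered stubs -/

/-- STUB 1 (KNOWN in print; L in the tree) — **the Lefschetz package of a smooth hypersurface.** For a
smooth hypersurface `X ⊂ ℙⁿ⁺¹_ℂ` of degree `d` and a rational `(k,k)`-class `c ∈ H²ᵏ(X(ℂ); ℂ)`: if
`2k ≠ n` then `H²ᵏ(X; ℚ) = ℚ·hᵏ` (resp. `ℚ·α` with `d α = hᵏ`) by the Lefschetz hyperplane theorem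
via the Veronese embedding (Voisin II Thm. 1.23, Cor. 1.24–1.25; the tree's named fact
`Voisin2003_smoothHypersurface_algebraicClasses_eq_top`, partial discharge
`HodgeTheory/HypersurfaceLefschetzUpper`), so `c` is algebraic; if `k ≤ 1` then `c` is a divisor class
(or a degree-`0` class) and is algebraic by Lefschetz's theorem on `(1,1)`-classes (Voisin I
Thm. 11.30; the tree's `LefschetzOneOne*` files) — this covers the middle degree of SURFACES (`n = 2`),
where the heart below is not claimed. Why it might fail: it does not (theorems in print); size = the
two Lefschetz theorems on the tree's real carriers.
[cite: VoisinHodgeII2003, Thm. 1.23, Cor. 1.24 and Cor. 1.25] [cite: VoisinHodgeI2002, Thm. 11.30] -/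
theorem stub_lefschetzPackage :
    ∀ ⦃n d : ℕ⦄ ⦃X : SchemeOver ℂ⦄, IsSmoothHypersurface n d X →
      ∀ k : ℕ, (2 * k ≠ n ∨ k ≤ 1) → ∀ c : complexBetti X (2 * k), IsRationalClass c →
        IsOfHodgeType n X (2 * k) k k c → c ∈ algebraicClasses X k := by
  sorry

/-- STUB 2 (THE HEART; open beyond Klingler–Otwinowska–Urbanik) — **type stability of MOVABLE
hypersurface classes at `ℚ̄`-generic points.** For `σ : ℚ̄ →+* ℂ`, a `ℚ̄`-morphism `f₀ : 𝒳₀ ⟶ S₀` of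
quasi-projective `ℚ̄`-schemes with `S₀` smooth irreducible whose complexification is a smooth projective
family of relative dimension `n`, a complex point `s` over the GENERIC point of `S₀` whose fibre `𝒳_s` is
a smooth `(n,d)`-hypersurface, `n = 2p ≥ 4`, and a rational `(p,p)`-class `α` on `𝒳_s` that MOVES
(`Moves n 𝒳_s p α`): there is a proper Zariski-closed `Z₀ ⊊ S₀` such that every flat continuation `β` of
`α` along a loop at `s` lying over `S₀ ∖ Z₀` is again of type `(p,p)`. Road in print: the fibres near `s`
are degree-`d` hypersurfaces (`n ≥ 3`: all deformations of a smooth hypersurface are hypersurfaces), so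
the spread maps (after a finite étale cover, over a dense open) to the universal family `U_{n,d}`; the
Hodge-locus component `Z` of the image of `(s, α)` is algebraic (Cattani–Deligne–Kaplan), POSITIVE
DIMENSIONAL for the variation because `α` moves (a non-isotrivial one-parameter family of hypersurfaces
has infinite monodromy: rigidity + infinitesimal Torelli), hence DEFINED OVER `ℚ̄` when weakly non-factor
(KOU 2023 Thm. 1.12 (a); always when maximal, Cor. 1.13, the adjoint generic Mumford–Tate group of
`U_{n,d}` being simple); a `ℚ̄`-closed set containing `[𝒳_s]` contains its `ℚ̄`-closure = the image of
`S₀`, so `α` stays of type `(p,p)` along every loop in the spread (off the bad locus `Z₀`). OPEN RESIDUE: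
Hodge-locus components of "factor" type (algebraic monodromy a strict normal subgroup of that of a larger
special subvariety), KOU Conj. 1.7. Why it might fail: a positive-dimensional component of the Hodge
locus of `U_{n,d}` of vector type which is not defined over `ℚ̄`, through a point whose `ℚ̄`-closure
leaves it — then the Hodge conjecture fails too (Voisin 2007 §0). This is the `Envelope` skeleton's
kernel `T` restricted to movable hypersurface classes (`typeStabilityOfMovable_of_T` below).
[cite: KlinglerOtwinowskaUrbanik2023, Thm. 1.12 (a), Cor. 1.13 and Cor. 1.14]
[cite: Voisin2007HodgeLoci, Thm. 1.5 (2), Cor. 1.6 and Prop. 1.7]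
[cite: CattaniDeligneKaplan1995JAMS, Thm. 1.1] [cite: BaldiKlinglerUllmo2024, Thm. 2.6 and Cor. 2.7] -/
theorem stub_typeStabilityOfMovable :
    ∀ (σ : AlgebraicClosure ℚ →+* ℂ) ⦃𝒳₀ S₀ : SchemeOver (AlgebraicClosure ℚ)⦄ (f₀ : 𝒳₀ ⟶ S₀)
      (n p d : ℕ), IsQuasiProjectiveOver 𝒳₀ → IsQuasiProjectiveOver S₀ → IrreducibleSpace S₀.left →
      AlgebraicGeometry.Smooth S₀.hom → IsSmoothProjectiveFamily ((baseChangeHom σ).map f₀) n →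
      ∀ (s : ComplexPoints ((baseChangeHom σ).obj S₀)),
        closure {(baseChangeHomFst σ S₀).base s.pt} = (Set.univ : Set S₀.left) →
        IsSmoothHypersurface n d (fiberOver ((baseChangeHom σ).map f₀) s) → 2 * p = n → 2 ≤ p →
        ∀ (α : complexBetti (fiberOver ((baseChangeHom σ).map f₀) s) (2 * p)),
          IsRationalClass α → IsOfHodgeType n (fiberOver ((baseChangeHom σ).map f₀) s) (2 * p) p p α →
          Moves n (fiberOver ((baseChangeHom σ).map f₀) s) p α →
          ∃ Z₀ : Set S₀.left, IsClosed Z₀ ∧ Z₀ ≠ Set.univ ∧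
            ∀ (γ : Path s s), (∀ u, (baseChangeHomFst σ S₀).base (γ u).pt ∉ Z₀) →
              ∀ (β : complexBetti (fiberOver ((baseChangeHom σ).map f₀) s) (2 * p)),
                IsContinuationAlong γ α β →
                  IsOfHodgeType n (fiberOver ((baseChangeHom σ).map f₀) s) (2 * p) p p β := by
  sorry

/-- STUB 3 (CLASSICAL — Voisin's mechanism; XL in the tree but almost all of it landed) — **a
finite-monodromy class at a `ℚ̄`-generic point is enveloped by a variety over a number field.** With the
spread data as in STUB 2 (no hypersurface, degree or movability hypothesis) and a rational
`(p,p)`-class `α` on `𝒳_s` whose continuation orbit along loops at `s` is FINITE: there are a smooth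
projective `W` of dimension `m` definable over a NUMBER FIELD (`W ≅ W₀ ⊗_{K,τ} ℂ`), a morphism
`ι : 𝒳_s ⟶ W` and a rational `(p,p)`-class `c'` on `W` with `ι^* c' = α`. In print: pass to the finite
étale cover of (the smooth locus of) `S₀` on which the orbit is fixed — it is algebraic and defined over
`ℚ̄` (Riemann's existence theorem, `π₁^ét(S_ℚ̄) = π₁^ét(S_ℂ)`) —, compactify the base-changed total space
to a smooth projective `ℚ̄`-scheme (Nagata, Hironaka), lift the invariant section to a Hodge class on it
(Deligne's théorème de la partie fixe, Hodge II 4.1.1, + semisimplicity of polarisable Hodge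
structures), and descend the `ℚ̄`-scheme to a number field (EGA IV₃ 8.8.2). In the tree: the PROVED
`Theorems.stub_dominantEnvelopeOfFiniteMonodromy` (p119525) fed with the named facts
`FundamentalGroup.riemannExistence_qbarDescent_of_finiteIndex` (stub C of `Cruxes/Envelope/Lines/birth.lean`)
and `deligne_globalInvariantCycles` (item stmt-HodgeConjecture-16363), plus number-field descent (stub N
there) — see `envelopeOfFiniteMonodromy_of_inputs` (PROVED). Why it might fail: it does not; it is
formalisation debt shared verbatim with the `Envelope` skeleton.
[cite: Voisin2007HodgeLoci, Prop. 1.7 (proof, §3)] [cite: CharlesSchnell2014Notes, Thm. 11.3.4 and Thm. 11.3.19]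
[cite: DeligneHodgeII1971, Théorème 4.1.1] [cite: SGA1, Exp. XII Thm. 5.1] [cite: EGAIV3, Thm. 8.8.2 (ii)] -/
theorem stub_envelopeOfFiniteMonodromy :
    ∀ (σ : AlgebraicClosure ℚ →+* ℂ) ⦃𝒳₀ S₀ : SchemeOver (AlgebraicClosure ℚ)⦄ (f₀ : 𝒳₀ ⟶ S₀)
      (n p : ℕ), IsQuasiProjectiveOver 𝒳₀ → IsQuasiProjectiveOver S₀ → IrreducibleSpace S₀.left →
      AlgebraicGeometry.Smooth S₀.hom → IsSmoothProjectiveFamily ((baseChangeHom σ).map f₀) n →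
      ∀ (s : ComplexPoints ((baseChangeHom σ).obj S₀)),
        closure {(baseChangeHomFst σ S₀).base s.pt} = (Set.univ : Set S₀.left) →
        ∀ (α : complexBetti (fiberOver ((baseChangeHom σ).map f₀) s) (2 * p)),
          IsRationalClass α → IsOfHodgeType n (fiberOver ((baseChangeHom σ).map f₀) s) (2 * p) p p α →
          {β : complexBetti (fiberOver ((baseChangeHom σ).map f₀) s) (2 * p) |
              ∃ γ : Path s s, IsContinuationAlong γ α β}.Finite →
          ∃ (m : ℕ) (W : SchemeOver ℂ) (ι : fiberOver ((baseChangeHom σ).map f₀) s ⟶ W)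
            (c' : complexBetti W (2 * p)),
            IsSmoothProjective m W ∧
            (∃ (K : Type) (_ : Field K) (_ : NumberField K) (τ : K →+* ℂ) (W₀ : SchemeOver K),
                Nonempty (W ≅ (baseChangeHom τ).obj W₀)) ∧
            IsRationalClass c' ∧ IsOfHodgeType m W (2 * p) p p c' ∧
            complexBetti.map ι (2 * p) c' = α := by
  sorry

/-- STUB 4 (SHARED CRUX, open) — **the Hodge conjecture over number fields**, the item
stmt-HodgeConjecture-1070 of route `QbarEnvelope`, BY NAME: for every smooth projective complex `X`
definable over a number field (`X ≅ X₀ ⊗_{K,σ} ℂ`), `HodgeConjectureFor n X`. Used here only for the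
envelopes `W` of STUB 3 (compactified total spaces of `ℚ̄`-families of hypersurfaces). Why it might
fail: it is the Hodge conjecture on `ℚ̄`-varieties (open already for Weil classes on CM abelian varieties
of Weil type from dimension 6 on); it closes here the moment stmt-1070 closes.
[cite: Voisin2007HodgeLoci, Prop. 1.7] [cite: Deligne1982HodgeCycles, Thm. 2.11] -/
theorem stub_hcOverNumberFields :
    Summit.HodgeConjecture.HodgeConjecture.Theses.QbarEnvelope.HCOverNumberFields := by
  sorry

/-- STUB 5 (SHARED SUPPORT, theorem in print) — **pull-back preserves algebraic classes**, the item
stmt-HodgeConjecture-1071 of route `QbarEnvelope`, BY NAME: for a `ℂ`-morphism `ι : X ⟶ W` of smooth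
projective varieties, `ι^*(Nᵖ H²ᵖ(W(ℂ); ℂ)) ⊆ Nᵖ H²ᵖ(X(ℂ); ℂ)` (refined Gysin pull-back `ι^!` for `W`
smooth, Fulton Ch. 6 and §8.1, and `cl(ι^! z) = ι^* cl(z)`, Fulton Cor. 19.2). Why it might fail: it
does not; size L (cycle class with supports on the tree's carriers).
[cite: Fulton1998, Ch. 6, §8.1 and Cor. 19.2] [cite: VoisinHodgeII2003, Prop. 9.21] -/
theorem stub_pullbackAlgebraic :
    Summit.HodgeConjecture.HodgeConjecture.Theses.QbarEnvelope.PullbackAlgebraic := by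
  sorry

/-! ### The composition: stub₁ → … → stub₅ → the crux, by name -/

/-- **THE LINE'S COMPOSITION** (kernel-checked, no `sorry`). Off the middle degree, or for `k ≤ 1`,
STUB 1. In the middle degree `n = 2k ≥ 4`: fix `σ : ℚ̄ →+* ℂ`; spread `X` out over `ℚ̄`
(`spreadingOut_smoothProjective_qbarFamily_holds`, PROVED: `e : X ≅ 𝒳_s`, `s` over the generic point);
`𝒳_s` is again a smooth `(n,d)`-hypersurface (`IsSmoothHypersurface.of_iso`) and `α := (e⁻¹)^* c`
moves on it (`Moves.of_iso`); STUB 2 gives Zariski-local type stability, the tree's loop-shrinking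
theorem (`IsContinuationAlong.exists_loop_forall_base_pt_notMem_of_qbarFamily`) makes it global, the
tree's finiteness theorem (Hodge–Riemann + lattice) gives the finite orbit; STUB 3 writes `α = ι^* c'`
with `c'` rational `(k,k)` on a smooth projective `W` over a number field; STUB 4 makes `c'` algebraic
on `W`; STUB 5 pulls it back along `e.hom ≫ ι : X ⟶ W`, and `(e.hom ≫ ι)^* c' = e^*(α) = c`
(`Iso.complexBetti_map_hom_map_inv`). [cite: Voisin2007HodgeLoci, Prop. 1.7] -/
theorem MovableClassesAlgebraic_of (h₁ : Stubs.stub_lefschetzPackage)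
    (h₂ : Stubs.stub_typeStabilityOfMovable) (h₃ : Stubs.stub_envelopeOfFiniteMonodromy)
    (h₄ : Stubs.stub_hcOverNumberFields) (h₅ : Stubs.stub_pullbackAlgebraic) :
    MovableClassesAlgebraic := by
  intro n d X hX k c hc hkk hmov
  by_cases hk : 2 * k = n ∧ 2 ≤ k
  · obtain ⟨hkn, hk2⟩ := hk
    -- an embedding `σ : ℚ̄ →+* ℂ`
    obtain ⟨σ⟩ := exists_ringHom_algebraicClosure_rat_complex
    -- spread `X` out over `ℚ̄`: `e : X ≅ 𝒳_s`, `s` over the generic point of the smooth irreducible `S₀`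
    obtain ⟨𝒳₀, S₀, f₀, s, h𝒳₀, hS₀, hirr, hsm, hf, hgen, ⟨e⟩⟩ :=
      spreadingOut_smoothProjective_qbarFamily_holds σ hX.1
    -- the transported data on the fibre `𝒳_s`
    have hα : IsRationalClass (complexBetti.map e.inv (2 * k) c) := hc.map _
    have hαkk : IsOfHodgeType n (fiberOver ((baseChangeHom σ).map f₀) s) (2 * k) k k
        (complexBetti.map e.inv (2 * k) c) := hkk.map_of_iso e.symm
    have hF : IsSmoothHypersurface n d (fiberOver ((baseChangeHom σ).map f₀) s) := hX.of_iso e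
    have hmovF : Moves n (fiberOver ((baseChangeHom σ).map f₀) s) k (complexBetti.map e.inv (2 * k) c) :=
      Moves.of_iso e hmov
    -- type stability: Zariski-local from the heart, global by loop shrinking (tree theorem)
    have hT : ∀ (γ : Path s s) (β : complexBetti (fiberOver ((baseChangeHom σ).map f₀) s) (2 * k)),
        IsContinuationAlong γ (complexBetti.map e.inv (2 * k) c) β →
          IsOfHodgeType n (fiberOver ((baseChangeHom σ).map f₀) s) (2 * k) k k β := by
      intro γ β hγ
      obtain ⟨Z₀, hZ₀, hZ₀', H⟩ :=
        h₂ σ f₀ n k d h𝒳₀ hS₀ hirr hsm hf s hgen hF hkn hk2 _ hα hαkk hmovF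
      haveI := hirr
      haveI := hsm
      obtain ⟨γ', hγ', hc'⟩ :=
        IsContinuationAlong.exists_loop_forall_base_pt_notMem_of_qbarFamily σ f₀ (2 * k) hS₀ hf hZ₀
          hZ₀' hgen hγ
      exact H γ' hγ' β hc'
    -- finite monodromy orbit (Hodge–Riemann + lattice finiteness — unconditional in the tree)
    have hfin :=
      Theorems.linearSystemTorelli_finite_setOf_isContinuationAlong_of_forall_isOfHodgeType σ f₀ n k hf
        h𝒳₀ hS₀ hirr hsm s (complexBetti.map e.inv (2 * k) c) hα hT
    -- the number-field envelope of the finite-orbit class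
    obtain ⟨m, W, ι, c', hW, hK, hc', hkk', hmap⟩ :=
      h₃ σ f₀ n k h𝒳₀ hS₀ hirr hsm hf s hgen _ hα hαkk hfin
    -- HC over number fields on the envelope, then pull back along `e.hom ≫ ι : X ⟶ W`
    have halg : c' ∈ algebraicClasses W k := (h₄ hW hK).2 k c' hc' hkk'
    have hpull := h₅ hX.1 hW (e.hom ≫ ι) k c' halg
    have hcomp : complexBetti.map (e.hom ≫ ι) (2 * k) c' = c := by
      rw [complexBetti.map_comp, ModuleCat.comp_apply, hmap]
      exact e.complexBetti_map_hom_map_inv (2 * k) c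
    rwa [hcomp] at hpull
  · exact h₁ hX k (by omega) c hc hkk

/-- **The crux, closed modulo exactly the five registered stubs.** -/
theorem MovableClassesAlgebraic_of_stubs : MovableClassesAlgebraic :=
  MovableClassesAlgebraic_of stub_lefschetzPackage stub_typeStabilityOfMovable
    stub_envelopeOfFiniteMonodromy stub_hcOverNumberFields stub_pullbackAlgebraic

/-! ### Proved sanity (no `sorry`): what the stubs are worth -/

/-- **Transitivity of base change**: `(X_φ)_σ ≅ X_{σ ∘ φ}` (Mathlib `Over.pullbackComp`; copied from
`Cruxes/Envelope/Lines/birth.lean`). [folklore] -/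
theorem nonempty_iso_baseChangeHom_comp {k L M : Type} [CommRing k] [CommRing L] [CommRing M]
    (φ : k →+* L) (σ : L →+* M) (X : SchemeOver k) :
    Nonempty ((baseChangeHom σ).obj ((baseChangeHom φ).obj X) ≅ (baseChangeHom (σ.comp φ)).obj X) := by
  have h : Spec.map (CommRingCat.ofHom (σ.comp φ)) =
      Spec.map (CommRingCat.ofHom σ) ≫ Spec.map (CommRingCat.ofHom φ) := by
    rw [CommRingCat.ofHom_comp, Spec.map_comp]
  refine ⟨((CategoryTheory.Over.pullbackComp (Spec.map (CommRingCat.ofHom σ))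
      (Spec.map (CommRingCat.ofHom φ))).app X).symm ≪≫ CategoryTheory.eqToIso ?_⟩
  change (CategoryTheory.Over.pullback _).obj X = (CategoryTheory.Over.pullback _).obj X
  rw [h]

/-- **STUB 3 is tracked debt**: it follows from Riemann's existence theorem with `ℚ̄`-descent (stub C
of the `Envelope` skeleton, as the named fact `riemannExistence_qbarDescent_of_finiteIndex`), Deligne's
partie fixe (`deligne_globalInvariantCycles`, item stmt-HodgeConjecture-16363) and number-field descent of
smooth projective `ℚ̄`-schemes (stub N there), through the tree's PROVED mechanism
`Theorems.stub_dominantEnvelopeOfFiniteMonodromy` (p119525) and `isSmoothProjective_of_baseChangeHom`.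
[cite: Voisin2007HodgeLoci, Prop. 1.7 (proof)] [cite: EGAIV3, Thm. 8.8.2 (ii)] -/
theorem envelopeOfFiniteMonodromy_of_inputs
    (hC : Literature.AlgebraicGeometry.FundamentalGroup.riemannExistence_qbarDescent_of_finiteIndex)
    (hD : deligne_globalInvariantCycles)
    (hN : ∀ ⦃m : ℕ⦄ (W₀ : SchemeOver (AlgebraicClosure ℚ)), IsSmoothProjective m W₀ →
      ∃ (K : Type) (_ : Field K) (_ : NumberField K) (ι : K →+* AlgebraicClosure ℚ)
        (W₁ : SchemeOver K), Nonempty (W₀ ≅ (baseChangeHom ι).obj W₁)) :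
    Stubs.stub_envelopeOfFiniteMonodromy := by
  intro σ 𝒳₀ S₀ f₀ n p h𝒳₀ hS₀ hirr hsm hf s hgen α hα hh hfin
  obtain ⟨m, W₀, ι, c', hW, -, hc', hh', hmap⟩ :=
    Theorems.stub_dominantEnvelopeOfFiniteMonodromy hC hD σ f₀ n p h𝒳₀ hS₀ hirr hsm hf s hgen α hα hh hfin
  obtain ⟨K, hK, hKn, ι₀, W₁, ⟨e₁⟩⟩ := hN W₀ (isSmoothProjective_of_baseChangeHom σ W₀ hW)
  obtain ⟨e₂⟩ := nonempty_iso_baseChangeHom_comp ι₀ σ W₁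
  exact ⟨m, (baseChangeHom σ).obj W₀, ι, c', hW,
    ⟨K, hK, hKn, σ.comp ι₀, W₁, ⟨(baseChangeHom σ).mapIso e₁ ≪≫ e₂⟩⟩, hc', hh', hmap⟩

/-- **The heart is implied by the `Envelope` skeleton's transcendence kernel `T` verbatim** (type
stability at `ℚ̄`-generic points for ALL rational `(p,p)`-classes, `Cruxes/Envelope/Lines/birth.lean`,
`stub_typeStabilityAtQbarGenericZariskiLocal`): the heart is `T` with four extra hypotheses
(hypersurface fibre, middle degree `≥ 4`, movable class) — the regime where KOU Thm. 1.12 bites.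
[cite: KlinglerOtwinowskaUrbanik2023, Thm. 1.12 (a)] -/
theorem typeStabilityOfMovable_of_T
    (hT : ∀ (σ : AlgebraicClosure ℚ →+* ℂ) ⦃𝒳₀ S₀ : SchemeOver (AlgebraicClosure ℚ)⦄ (f₀ : 𝒳₀ ⟶ S₀)
      (n p : ℕ), IsQuasiProjectiveOver 𝒳₀ → IsQuasiProjectiveOver S₀ → IrreducibleSpace S₀.left →
      AlgebraicGeometry.Smooth S₀.hom → IsSmoothProjectiveFamily ((baseChangeHom σ).map f₀) n →
      ∀ (s : ComplexPoints ((baseChangeHom σ).obj S₀)),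
        closure {(baseChangeHomFst σ S₀).base s.pt} = (Set.univ : Set S₀.left) →
        ∀ (α : complexBetti (fiberOver ((baseChangeHom σ).map f₀) s) (2 * p)),
          IsRationalClass α → IsOfHodgeType n (fiberOver ((baseChangeHom σ).map f₀) s) (2 * p) p p α →
          ∃ Z₀ : Set S₀.left, IsClosed Z₀ ∧ Z₀ ≠ Set.univ ∧
            ∀ (γ : Path s s), (∀ u, (baseChangeHomFst σ S₀).base (γ u).pt ∉ Z₀) →
              ∀ (β : complexBetti (fiberOver ((baseChangeHom σ).map f₀) s) (2 * p)),
                IsContinuationAlong γ α β →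
                  IsOfHodgeType n (fiberOver ((baseChangeHom σ).map f₀) s) (2 * p) p p β) :
    Stubs.stub_typeStabilityOfMovable :=
  fun σ _ _ f₀ n p _ h𝒳₀ hS₀ hirr hsm hf s hgen _ _ _ α hα hh _ ↦
    hT σ f₀ n p h𝒳₀ hS₀ hirr hsm hf s hgen α hα hh

/-- **The portfolio junction, formal**: the three items of route `QbarEnvelope` (`Envelope`,
`HCOverNumberFields`, `PullbackAlgebraic`) already imply the whole crux — for a movable (indeed any)
rational `(k,k)`-class take the envelope `(W, ι, c')`, make `c'` algebraic over the number field and pull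
back. This line is the refinement of `Envelope` to its MOVABLE HYPERSURFACE part, where the
field-of-definition input is Klingler–Otwinowska–Urbanik's theorem rather than a conjecture.
[cite: Voisin2007HodgeLoci, Prop. 1.7] -/
theorem of_qbarEnvelope (hE : Summit.HodgeConjecture.HodgeConjecture.Theses.QbarEnvelope.Envelope)
    (hH : Summit.HodgeConjecture.HodgeConjecture.Theses.QbarEnvelope.HCOverNumberFields)
    (hP : Summit.HodgeConjecture.HodgeConjecture.Theses.QbarEnvelope.PullbackAlgebraic) :
    MovableClassesAlgebraic := by
  intro n d X hX k c hc hkk _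
  obtain ⟨m, W, ι, c', hW, hK, hc', hkk', hmap⟩ := hE hX.1 k c hc hkk
  have h := hP hX.1 hW ι k c' ((hH hW hK).2 k c' hc' hkk')
  rwa [hmap] at h

/-- **Tightness of STUB 1's side condition**: the heart and the funnel are only invoked for `n = 2k`,
`k ≥ 2`; the complementary condition is exactly STUB 1's hypothesis (pure arithmetic). [folklore] -/
theorem side_condition (n k : ℕ) : ¬(2 * k = n ∧ 2 ≤ k) ↔ (2 * k ≠ n ∨ k ≤ 1) := by
  omega

end Summit.HodgeConjecture.HodgeConjecture.Cruxes.MovableClassesAlgebraic.KouFunnel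

end
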